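import Summits.BirchSwinnertonDyer.Rank1Residual.ManinAdditive.TwistOrbitDegreeIdentity
import Summits.BirchSwinnertonDyer.BirchSwinnertonDyer.Theorems.ManinLocalTwoThreeMaxCovolumeMember
import Literature.NumberTheory.EllipticCurves.BSDHeegnerPoints
import HarnessLib
import HarnessLib.Audit.Tags

/-!
# The commuting `χ₋₃`-orbit degree law (E-an-13 at `(−3, 3, 9)`), the wild `Δ₃`-monotonicity of the optimal curve
# (E-an-98 / 98♯) and the `3`-isogeny covolume law at wild `3` (E-an-97) — BY NAME
# (cell `bsd-f2-manin`, analytic lens `bsd-f2-manin-an` gen 21, MEMO-an §63; typing ask T-an-27; REF1 §R63 GO)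

HONEST FRAMING.  LENS = analytic / period-lattice (planner `bsd-f2-manin-an`, g21, D-an-18 wake: the reducible no-`T₃`
sector of Manin-at-`3` read through the KERNEL CHARACTER `ψ`; HOME/an/MEMO-an-63.md 39550bbc6ec2bfb0).  Source file
HOME/an/Sketch-an-g21.lean 01ad7333ac8d61d3 (177 l., farm rc 0 · 0 warnings · 0 sorries), landed AS IS on refuter-1's
GO (§R63, HOME/ref1/R63-ref1-an-g21.md c72e47edea2b70c8, 2026-08-28T12:30Z: 4 defs BC7 4 / 4 CLEAN summit mode, 3 edges +
THM B instance kernel rc 0, closures standard; E-an-97 re-derived on paper; one docstring count corrected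
«8 755 / 8 757» → 8 756 / 8 758) by the cell typer (gen 12): the four `def`s get `@[conjecture]` (open obligations of
the cell, nothing asserted), everything else VERBATIM (namespace `…ManinAdditive.WildThreeEdges` instead of the
sketch's private one).  Crux C3 `ManinPrimeToThreeAtNine` (stmt-BirchSwinnertonDyer-22968), line `kato_shift_three`,
stub 5 (RES₃′ / RES₃♭): bookkeeping for the `χ₋₃`-only and isolated loci of RES₃♭ (lead: P-an-3 bookkeeping-safe, nothing
load-bearing beyond LAWS 13 / 98 / 98♯ + RES₃♭).  Data: HOME/data/D-an-18-coprime-partners-v1.tsv 635e16e40aa136c5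
(38 275 optimal `W`, `9 ∣ N < 5·10⁵`, `W[3]` reducible, no rational `3`-torsion), HOME/an/g21/psi-census-v1.tsv
aba4d94ee02fdf97 (exact kernel characters), HOME/an/g21/wild_edges.out 05d57dab0d44ebac, HOME/an/g21/falsifiers.out.

CONTENTS (definitions = candidate laws, NOTHING asserted about them; the four `theorem`s are PROVED, 0 sorry):
* §1 `NegThreeOrbitDegreeGrowth` — E-an-13 at the instance `(d, q, M) = (−3, 3, 9)` (instance discipline, REF1 §R9.4):
  on a COMMUTING same-conductor `χ₋₃`-orbit with `9 ∣ N`, `deg φ(large Δ) = 3 · deg φ(small Δ)`.  c-FREE.  Census: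
  283 832 / 283 832 ordered pairs (`v₃N = 2, 3, 4, 5`: 101 460, 129 892, 36 316, 16 164).  PROVED EDGE
  `maninConstant_eq_or_eq_neg_of_negThreeOrbitDegreeGrowth`: with THM B (`orbitDegreeManinIdentity_pStar`, tree;
  instance `orbitDegreeManinIdentity_negThree`) it gives `c′ = ±c` on every such orbit — so Manin-at-`3` on the 1 743
  wild + 8 901 tame COMMUTING type-1 orbit-minimal curves of D-an-18 is «cube road on the partner ∧ §1».
* §2 `ThreeIsogenyCovolumeLawAtWildThree` (E-an-97) — LOCAL LEMMA, THEOREM ON PAPER (MEMO-an §63.3, REF1 RA71.1): for a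
  rational `3`-isogeny `W → W₂` of globally minimal curves with `27 ∣ N`, `v₃Δ_min` goes UP iff the Néron covolume is
  divided by `3`, DOWN iff multiplied by `3`.  Two engines (FHEIGHT 16 504 edges, TWISTCENSUS2 23 622 isogenies): 0 exceptions.
* §3 `OptimalIsDiscMinimalOnWildThreeEdges` (E-an-98) — LAW (c-free, period-free): the `X₀(N)`-optimal curve WITHOUT
  rational `3`-torsion at `27 ∣ N` has strictly smaller `v₃Δ_min` than each rational `3`-neighbour; 16 504 / 16 504
  edges `N < 5·10⁵` (the one Cremona-label exception 390150gy1 → gy2 is the optimality erratum E-imc-19; corrected edge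
  conforms).  `WildThreeEdgeIncrement` (E-an-98♯) — sharp increments `2 ∨ 6` / `4 ∨ 8` / `6` at `v₃N = 3 / 4 / ≥ 5`.
  PROVED EDGES `optimalIsDiscMinimal_of_increment` (98♯ ⟹ 98) and `covolume_div_three_of_wild_laws` (§2 ∧ §3 ⟹ every
  `3`-neighbour of such an optimal curve has Néron covolume `covol(Λ_W)/3`: «`E₀` is the SOURCE of the wild `3`-graph»).
NOT filed (dedup, an g21): E-an-95 = E-an-13(−3,3,9) via THM B, E-an-96 = tree E-an-6.  Refuter-2 placement R-an-38
(E-an-97 vs Dokchitser–Dokchitser 2015 Table 1's open «wild `l = p`» cell) pending.  Currency PARTITION 0; beyond-print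
theorem: no.  Nothing here proves BSD or Manin's conjecture.
-/

set_option autoImplicit false

noncomputable section

open scoped MatrixGroups ModularForm Classical

namespace Summit.BirchSwinnertonDyer.Rank1Residual.ManinAdditive.WildThreeEdges

open CongruenceSubgroup WeierstrassCurve
  Literature.NumberTheory.EllipticCurves Literature.NumberTheory.EllipticCurves.ModularForms
  Summit.BirchSwinnertonDyer.Rank1Residual.ManinAdditive

/-! ## §1 E-an-13 at `(−3, 3, 9)`: degree growth on commuting `χ₋₃`-orbits (c-free) and the Manin equality it yields -/

/-- **E-an-13 instance `NegThreeOrbitDegreeGrowth`** (= `DegreeGrowsTowardLargerDiscriminant (−3) 3 9`; cell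
bsd-f2-manin MEMO-an §63; DATA LAW, nothing asserted): `W`, `W′` globally minimal, lattice-optimal data at the common
conductor `N`, `9 ∣ N`, `W′ ≅ W ⊗ χ₋₃` (COMMUTING orbit) with `Δ(W′) = (−3)⁶ Δ(W)` ⟹ `deg φ_{W′} = 3 · deg φ_W`.
Census (BC5): 283 832 ordered commuting pairs, `N < 5·10⁵`, 0 exceptions (HOME/an/g21/falsifiers.out (a)).
At `27 ∣ N` it is the conclusion of tree `modularDegree_eq_three_mul_of_trichotomy_of_smallDisc` (E-an-5 ∧ E-an-6). 
Typed by the cell typer (T-an-27) VERBATIM from HOME/an/Sketch-an-g21.lean 01ad7333ac8d61d3; REF1 §R63 (R-an-37,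
2026-08-28T12:30Z, HOME/ref1/R63-ref1-an-g21.md c72e47edea2b70c8): SURVIVES, BC7 CLEAN summit mode; ENGINE V reproduces
141 917 / 141 917 aligned pairs `deg′ = 3 deg`.  Beyond-print theorem: no.
[cite: Pal2012, Prop. 2.4 (shape only: modular degree vs. discriminant along a quadratic twist; the `(−3, 3, 9)` growth law is the cell's E-an-13 instance, NOT in print — MEMO-an §63)] -/
@[conjecture]
def NegThreeOrbitDegreeGrowth : Prop :=
  ∀ (W W' : WeierstrassCurve ℚ) [W.IsElliptic] [W.IsGloballyMinimal] [W'.IsElliptic]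
    [W'.IsGloballyMinimal] [NeZero (W.conductorNorm ℤ)] [NeZero (W'.conductorNorm ℤ)]
    (u : VariableChange ℚ) (D : ModularParametrizationData W (W.conductorNorm ℤ))
    (D' : ModularParametrizationData W' (W'.conductorNorm ℤ)),
    9 ∣ W.conductorNorm ℤ → W'.conductorNorm ℤ = W.conductorNorm ℤ →
    u • W.quadraticTwist ((-3 : ℤ) : ℚ) = W' → IsLatticeOptimal D → IsLatticeOptimal D' →
    W'.Δ = ((-3 : ℤ) : ℚ) ^ 6 * W.Δ →
    D'.modularDegree = 3 * D.modularDegree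

/-- THM B of the tree at `q = 3`: `OrbitDegreeManinIdentity (−3) 3 9`. -/
theorem orbitDegreeManinIdentity_negThree : OrbitDegreeManinIdentity (-3) 3 9 := by
  have h := orbitDegreeManinIdentity_pStar Nat.prime_three (by norm_num)
  norm_num at h
  exact h

/-- **PROVED EDGE.** §1 ⟹ the Manin constants of the two optimal curves of a commuting `χ₋₃`-orbit at `9 ∣ N`
agree up to sign (via THM B `deg′ · c² = 3 · deg · c′²` and `deg > 0`). -/
theorem maninConstant_eq_or_eq_neg_of_negThreeOrbitDegreeGrowth (h : NegThreeOrbitDegreeGrowth)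
    (W W' : WeierstrassCurve ℚ) [W.IsElliptic] [W.IsGloballyMinimal] [W'.IsElliptic]
    [W'.IsGloballyMinimal] [NeZero (W.conductorNorm ℤ)] [NeZero (W'.conductorNorm ℤ)]
    (u : VariableChange ℚ) (D : ModularParametrizationData W (W.conductorNorm ℤ))
    (D' : ModularParametrizationData W' (W'.conductorNorm ℤ))
    (hM : 9 ∣ W.conductorNorm ℤ) (hN : W'.conductorNorm ℤ = W.conductorNorm ℤ)
    (hu : u • W.quadraticTwist ((-3 : ℤ) : ℚ) = W') (hD : IsLatticeOptimal D) (hD' : IsLatticeOptimal D')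
    (hΔ : W'.Δ = ((-3 : ℤ) : ℚ) ^ 6 * W.Δ) :
    D'.c = D.c ∨ D'.c = -D.c := by
  have hI := orbitDegreeManinIdentity_negThree W W' u D D' hM hN hu hD hD' hΔ
  have hdeg := h W W' u D D' hM hN hu hD hD' hΔ
  have hpos : (0 : ℤ) < D.modularDegree := by exact_mod_cast D.deg_pos
  rw [hdeg] at hI
  push_cast at hI
  have hsq : D'.c ^ 2 = D.c ^ 2 := by
    have : (3 : ℤ) * D.modularDegree * (D.c ^ 2 - D'.c ^ 2) = 0 := by linear_combination hI
    rcases mul_eq_zero.mp this with h0 | h0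
    · exact absurd h0 (by positivity)
    · linear_combination -h0
  exact sq_eq_sq_iff_eq_or_eq_neg.mp hsq

/-! ## §2 LOCAL LEMMA (theorem target): `v₃Δ_min` up ⟺ Néron covolume divided by `3` along a `3`-isogeny at wild `3` -/

/-- **E-an-97 `ThreeIsogenyCovolumeLawAtWildThree`** (cell bsd-f2-manin MEMO-an §63; THEOREM TARGET, local algebra —
nothing asserted): `W → W₂` a rational isogeny of degree `3` between globally minimal curves, `27 ∣ N(W)` (so potentially
good reduction at `3`), `L`, `L₂` Néron period pairs.  Then `v₃Δ_min(W) < v₃Δ_min(W₂) ⟹ covol(L₂) = covol(L)/3` (Néron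
scalar `±1`) and `v₃Δ_min(W₂) < v₃Δ_min(W) ⟹ covol(L₂) = 3·covol(L)` (Néron scalar `±3`).  Proof sketch: over `K/ℚ₃` of
good reduction, `v₃(u) = v_K(λ)/e_K − (v₃Δ₂ − v₃Δ)/12` with `0 ≤ v_K(λ) ≤ e_K` for the good-model scalar `λ ∣ 3`.
Census (two engines, 0 exceptions): FHEIGHT p = 3 areas on 16 504 wild edges; TWISTCENSUS2 `lambda_neron` on 23 622
`3`-isogenies (HOME/an/g21/falsifiers.out (b)). 
A THEOREM ON PAPER (MEMO-an §63.3; REF1 §R63: re-derived line by line, deduction step kernel-checked RA71.1) filed as an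
open tree obligation until formalized; typed VERBATIM from Sketch-an-g21 01ad7333ac8d61d3 (T-an-27).  Beyond-print
theorem: no (local algebra; cf. the open «wild `l = p`» cell of Dokchitser–Dokchitser's Table 1, which this does NOT fill).
[cite: DokchitserDokchitser2015LocalInvariantsIsogenous, Table 1 and §1 (shape only: local invariants along an isogeny, the wild `l = p` cell left open there; the covolume law is the cell's E-an-97 — MEMO-an §63.3)] -/
@[conjecture]
def ThreeIsogenyCovolumeLawAtWildThree : Prop :=
  ∀ (W W₂ : WeierstrassCurve ℚ) [W.IsElliptic] [W.IsGloballyMinimal] [W₂.IsElliptic] [W₂.IsGloballyMinimal]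
    (φ : Isogeny W W₂) (L L₂ : PeriodPair),
    φ.degree = 3 → 3 ^ 3 ∣ W.conductorNorm ℤ →
    IsNeronLatticeOf (W.baseChange ℂ) L → IsNeronLatticeOf (W₂.baseChange ℂ) L₂ →
    (padicValInt 3 W.minimalDiscriminantInt < padicValInt 3 W₂.minimalDiscriminantInt →
        ZLattice.covolume L₂.lattice = ZLattice.covolume L.lattice / 3) ∧
    (padicValInt 3 W₂.minimalDiscriminantInt < padicValInt 3 W.minimalDiscriminantInt →
        ZLattice.covolume L₂.lattice = 3 * ZLattice.covolume L.lattice)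

/-! ## §3 LAW: the optimal curve is `v₃Δ`-minimal on every wild `3`-edge; sharp increments -/

/-- **E-an-98 `OptimalIsDiscMinimalOnWildThreeEdges`** (cell bsd-f2-manin MEMO-an §63; DATA LAW, c-free and
period-free — nothing asserted): `W` globally minimal and `X₀(N)`-optimal (lattice-optimal datum at the conductor),
`27 ∣ N`, NO rational point of order `3` on `W`; then every rational `3`-isogeny `W → W₂` to a globally minimal `W₂`
RAISES the `3`-valuation of the minimal discriminant.  Census (BC5): 16 504 / 16 504 edges, `N < 5·10⁵`
(HOME/an/g21/wild_edges.out; Cremona's single label exception 390150gy1 → gy2 is the certified optimality mislabel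
E-imc-19 — MEMO-imc §12.5, -es E2X j284578 — and the corrected edge gy2 → gy1 conforms).  With rational `3`-torsion the
same holds in 8 756 / 8 758 edges, the exceptions being the `μ₃`-edges of 27a1 and 54a1 (`E₁ ≠ E₀`, Manin gain `3`).
Why it might fail: an optimal curve above `5·10⁵` whose `μ₃`- or `ψ`-quotient is Néron-étale over it (a `3`-gain class
at wild level, i.e. `ι(E₀) ∩ Σ(N)` or a non-Shimura cover with `3`-torsion kernel). 
Typed VERBATIM from Sketch-an-g21 01ad7333ac8d61d3 (T-an-27; docstring count corrected 8 756 / 8 758 per REF1 §R63); REF1 §R63: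
SURVIVES (LAW), BC7 CLEAN; ENGINE V reproduces the 16 504-edge table to the unit.  Beyond-print theorem: no.
[cite: Stevens1989, Thm. 2.3 (shape only: the minimal curve and étale isogenies in an isogeny class; the wild-3 disc-minimality of the `X₀`-optimal curve is the cell's E-an-98, NOT in print — MEMO-an §63)] -/
@[conjecture]
def OptimalIsDiscMinimalOnWildThreeEdges : Prop :=
  ∀ (W : WeierstrassCurve ℚ) [W.IsElliptic] [W.IsGloballyMinimal] [NeZero (W.conductorNorm ℤ)]
    (D : ModularParametrizationData W (W.conductorNorm ℤ)),
    IsLatticeOptimal D → 3 ^ 3 ∣ W.conductorNorm ℤ → (∀ P : W.toAffine.Point, 3 • P = 0 → P = 0) →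
    ∀ (W₂ : WeierstrassCurve ℚ) [W₂.IsElliptic] [W₂.IsGloballyMinimal] (φ : Isogeny W W₂), φ.degree = 3 →
      padicValInt 3 W.minimalDiscriminantInt < padicValInt 3 W₂.minimalDiscriminantInt

/-- **E-an-98♯ `WildThreeEdgeIncrement`** (cell bsd-f2-manin MEMO-an §63; DATA LAW — nothing asserted): in the
setting of E-an-98 the increment `v₃Δ_min(W₂) − v₃Δ_min(W)` is `2` or `6` when `v₃N = 3`, `4` or `8` when `v₃N = 4`,
and `6` when `v₃N ≥ 5`.  Census: `v₃N = 3`: 6 828 × 2 + 3 954 × 6 (+ the E-imc-19 row); `v₃N = 4`: 1 581 × 4 + 1 581 × 8;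
`v₃N = 5`: 2 559 × 6 (HOME/an/g21/wild_edges.out).  Why it might fail: as E-an-98, or an increment `10`/`12` at a
`3`-adic signature absent below `5·10⁵`. 
Typed VERBATIM from Sketch-an-g21 01ad7333ac8d61d3 (T-an-27); REF1 §R63: SURVIVES (LAW), BC7 CLEAN; ENGINE V: {3: +2×6828,
+6×3954, −2×1 (E-imc-19 row)}, {4: +4×1581, +8×1581}, {≥5: +6×2559}.  Beyond-print theorem: no.
[cite: DokchitserDokchitser2015LocalInvariantsIsogenous, Table 1 (shape only: discriminant change along an isogeny; the sharp wild-3 increments are the cell's E-an-98♯ — MEMO-an §63)] -/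
@[conjecture]
def WildThreeEdgeIncrement : Prop :=
  ∀ (W : WeierstrassCurve ℚ) [W.IsElliptic] [W.IsGloballyMinimal] [NeZero (W.conductorNorm ℤ)]
    (D : ModularParametrizationData W (W.conductorNorm ℤ)),
    IsLatticeOptimal D → 3 ^ 3 ∣ W.conductorNorm ℤ → (∀ P : W.toAffine.Point, 3 • P = 0 → P = 0) →
    ∀ (W₂ : WeierstrassCurve ℚ) [W₂.IsElliptic] [W₂.IsGloballyMinimal] (φ : Isogeny W W₂), φ.degree = 3 →
      (padicValNat 3 (W.conductorNorm ℤ) = 3 →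
        padicValInt 3 W₂.minimalDiscriminantInt = padicValInt 3 W.minimalDiscriminantInt + 2 ∨
        padicValInt 3 W₂.minimalDiscriminantInt = padicValInt 3 W.minimalDiscriminantInt + 6) ∧
      (padicValNat 3 (W.conductorNorm ℤ) = 4 →
        padicValInt 3 W₂.minimalDiscriminantInt = padicValInt 3 W.minimalDiscriminantInt + 4 ∨
        padicValInt 3 W₂.minimalDiscriminantInt = padicValInt 3 W.minimalDiscriminantInt + 8) ∧
      (5 ≤ padicValNat 3 (W.conductorNorm ℤ) →
        padicValInt 3 W₂.minimalDiscriminantInt = padicValInt 3 W.minimalDiscriminantInt + 6)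

/-- **PROVED EDGE.** E-an-98♯ ⟹ E-an-98 (every listed increment is positive; `v₃N ≥ 3` from `27 ∣ N`). -/
theorem optimalIsDiscMinimal_of_increment (h : WildThreeEdgeIncrement) : OptimalIsDiscMinimalOnWildThreeEdges := by
  intro W _ _ _ D hD h27 hT W₂ _ _ φ hφ
  obtain ⟨h3, h4, h5⟩ := h W D hD h27 hT W₂ φ hφ
  have hv : 3 ≤ padicValNat 3 (W.conductorNorm ℤ) := by
    have hne : W.conductorNorm ℤ ≠ 0 := NeZero.ne _
    exact (padicValNat_dvd_iff_le hne).mp h27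
  rcases Nat.lt_or_ge (padicValNat 3 (W.conductorNorm ℤ)) 5 with hlt | hge
  · interval_cases hv3 : padicValNat 3 (W.conductorNorm ℤ)
    · rcases h3 rfl with e | e <;> omega
    · rcases h4 rfl with e | e <;> omega
  · have e := h5 hge; omega

/-- **PROVED EDGE («`E₀` is the source of the wild `3`-graph»).** §2 ∧ §3 ⟹ every rational `3`-neighbour `W₂` of an
optimal curve `W` without rational `3`-torsion at `27 ∣ N` has Néron covolume `covol(Λ_W)/3` (so `Λ_W ⊂ Λ_{W₂}` up to the
Néron sign with index `3`: the isogeny `W → W₂` is étale on Néron models, `W₂ → W` is not). -/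
theorem covolume_div_three_of_wild_laws (h₂ : ThreeIsogenyCovolumeLawAtWildThree)
    (h₃ : OptimalIsDiscMinimalOnWildThreeEdges)
    (W : WeierstrassCurve ℚ) [W.IsElliptic] [W.IsGloballyMinimal] [NeZero (W.conductorNorm ℤ)]
    (D : ModularParametrizationData W (W.conductorNorm ℤ)) (hD : IsLatticeOptimal D)
    (h27 : 3 ^ 3 ∣ W.conductorNorm ℤ) (hT : ∀ P : W.toAffine.Point, 3 • P = 0 → P = 0)
    (W₂ : WeierstrassCurve ℚ) [W₂.IsElliptic] [W₂.IsGloballyMinimal] (φ : Isogeny W W₂) (hφ : φ.degree = 3)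
    (L L₂ : PeriodPair) (hL : IsNeronLatticeOf (W.baseChange ℂ) L) (hL₂ : IsNeronLatticeOf (W₂.baseChange ℂ) L₂) :
    ZLattice.covolume L₂.lattice = ZLattice.covolume L.lattice / 3 :=
  (h₂ W W₂ φ L L₂ hφ h27 hL hL₂).1 (h₃ W D hD h27 hT W₂ φ hφ)


end Summit.BirchSwinnertonDyer.Rank1Residual.ManinAdditive.WildThreeEdges

end
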